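import Mathlib
import Summits.ValiantsHypothesis.ValiantsHypothesis.Theorems.LacunarySymmetroidMatrixDescartesInertiaWindow
import Summits.ValiantsHypothesis.ValiantsHypothesis.Theorems.LacunarySymmetroidMatrixDescartesDetMultiplicityJordanChain

/-!
# `MatrixDescartes` (stmt-ValiantsHypothesis-18050) — the DEFINITE-MOMENTS LAW, zones EXACT I: a directed window with
# definite ends of opposite signs carries kernels of total dimension EXACTLY `card ι`, and — when the Rayleigh zeros are
# simple — EXACTLY `card ι` roots of `det F` counted with multiplicity

HONEST FRAMING.  Cell `pub-symmetroid`, seat `val-sym-mdr-p2` (gen 16); helper file `--supports` the crux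
`Theses.LacunarySymmetroid.MatrixDescartes`, NO closure claim.  Sharpens gen 14's window engine
(`DefiniteMoments.card_roots_window_le`: at most `card ι` DISTINCT zeros) to an EXACT count with multiplicity; a sector law
beside the crux; nothing here bears on the crux in its window, on `stub_twoSided`, on `DoorA26`/`DoorA34`, registers, or
`VP ≠ VNP`.

THEOREM (`sum_corank_window_eq`).  `F(x) = ∑ₖ x^{dₖ} Sₖ` with real symmetric letters; a window `a < b` with
`c·F(a) ≻ 0 ≻ c·F(b)` in which every Rayleigh form `x ↦ vᵀF(x)v` (`v ≠ 0`) has at most one zero.  Then the kernels of `F`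
at the roots of `det F` in `(a, b)` have total dimension EXACTLY `card ι`: `∑_{t ∈ (a,b), det F(t) = 0} dim ker F(t) = card ι`.
UPPER (`negIndex_add_sum_corank_le_of_directed`, pure algebra, any symmetric matrix family): the Rayleigh signs propagate
one way (gen 14's `scalar_up/_down`), so the non-positive eigenvectors at a scale (`ν + corank` of them) span a NEGATIVE
subspace at every later scale — the negative index climbs by at least the corank at each point (Sylvester,
`Inertia.card_le_negIndex`).  LOWER (`Inertia.negIndex_le_add_sum_corank`, topology): the index climbs from `0` to `card ι`
and jumps by at most the corank at each root.  WITH MULTIPLICITY (`card_roots_window_eq`): if moreover every Rayleigh zero in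
the window is SIMPLE (`P_v′ ≠ 0` there), each root `t` has `mult_t det F = dim ker F(t)` (first-order multiplicity law,
`Multiplicity.rootMultiplicity_det_pencil_eq_corank`), so `det F` has EXACTLY `card ι` roots in `(a, b)` COUNTED WITH
MULTIPLICITY — Markus' count «each spectral zone carries `n` eigenvalues» (A.S. Markus, Introduction to the spectral theory
of polynomial operator pencils, 1988, §31) in lacunary real-symmetric form. [folklore]; axioms standard; no definitions.
-/

-- layout Summits/ValiantsHypothesis/ValiantsHypothesis forces the duplicated namespace component
set_option linter.dupNamespace false

namespace Summit.ValiantsHypothesis.ValiantsHypothesis.Theorems.LacunarySymmetroidMatrixDescartes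

open Polynomial Matrix Finset
open scoped BigOperators Topology

namespace DefiniteMoments

variable {ι : Type} [Fintype ι] [DecidableEq ι]

/-! ## §1 Directed windows: the index climbs by at least the corank at every scale -/

omit [Fintype ι] [DecidableEq ι] in
/-- Three-way split of an open-window sum at an interior point of `T`. [folklore] -/
theorem sum_filter_Ioo_split3 (T : Finset ℝ) (f : ℝ → ℕ) {a t₀ b : ℝ} (hat : a < t₀) (htb : t₀ < b) (ht₀ : t₀ ∈ T) :
    ∑ t ∈ T.filter (fun t => a < t ∧ t < b), f t
      = ∑ t ∈ T.filter (fun t => a < t ∧ t < t₀), f t + f t₀ + ∑ t ∈ T.filter (fun t => t₀ < t ∧ t < b), f t := by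
  have hdisj1 : Disjoint (T.filter (fun t => a < t ∧ t < t₀)) {t₀} := by
    rw [Finset.disjoint_singleton_right, Finset.mem_filter]
    rintro ⟨-, -, h⟩; exact lt_irrefl _ h
  have hdisj2 : Disjoint (T.filter (fun t => a < t ∧ t < t₀) ∪ {t₀}) (T.filter (fun t => t₀ < t ∧ t < b)) := by
    rw [Finset.disjoint_left]
    intro t ht ht'
    obtain ⟨-, h1, -⟩ := Finset.mem_filter.1 ht'
    rcases Finset.mem_union.1 ht with h | h
    · obtain ⟨-, -, h2⟩ := Finset.mem_filter.1 h; exact lt_asymm h1 h2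
    · rw [Finset.mem_singleton] at h; rw [h] at h1; exact lt_irrefl _ h1
  have heq : T.filter (fun t => a < t ∧ t < b)
      = (T.filter (fun t => a < t ∧ t < t₀) ∪ {t₀}) ∪ T.filter (fun t => t₀ < t ∧ t < b) := by
    ext t
    simp only [Finset.mem_filter, Finset.mem_union, Finset.mem_singleton]
    constructor
    · rintro ⟨htT, h1, h2⟩
      rcases lt_trichotomy t t₀ with h | h | h
      · exact Or.inl (Or.inl ⟨htT, h1, h⟩)
      · exact Or.inl (Or.inr h)
      · exact Or.inr ⟨htT, h, h2⟩
    · rintro ((⟨htT, h1, h2⟩ | rfl) | ⟨htT, h1, h2⟩)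
      · exact ⟨htT, h1, lt_trans h2 htb⟩
      · exact ⟨ht₀, hat, htb⟩
      · exact ⟨htT, lt_trans hat h1, h2⟩
  rw [heq, Finset.sum_union hdisj2, Finset.sum_union hdisj1, Finset.sum_singleton]

/-- **DIRECTED WINDOW, negative form (pure algebra).**  `F : ℝ → Sym`; on `[a, b]` non-positivity of a Rayleigh form
propagates to strict negativity at every later scale.  Then for every finite set `T`:
`ν(F(a)) + corank F(a) + ∑_{t ∈ T, a < t < b} corank F(t) ≤ ν(F(b))` — the negative index climbs by at least the corank at
every scale (the non-positive eigenvectors at a scale span a negative subspace later; Sylvester). [folklore] -/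
theorem negIndex_add_sum_corank_le_of_directed (F : ℝ → Matrix ι ι ℝ) (hH : ∀ x, (F x).IsHermitian) (T : Finset ℝ) :
    ∀ (n : ℕ) (a b : ℝ), a < b → (T.filter (fun t => a < t ∧ t < b)).card ≤ n →
      (∀ v : ι → ℝ, v ≠ 0 → ∀ s t : ℝ, a ≤ s → s < t → t ≤ b →
        v ⬝ᵥ (F s *ᵥ v) ≤ 0 → v ⬝ᵥ (F t *ᵥ v) < 0) →
      Fintype.card {j // (hH a).eigenvalues j < 0} + (Fintype.card ι - (F a).rank)
          + ∑ t ∈ T.filter (fun t => a < t ∧ t < b), (Fintype.card ι - (F t).rank)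
        ≤ Fintype.card {j // (hH b).eigenvalues j < 0} := by
  classical
  -- the one-step climb, used in the base case
  have step : ∀ a b : ℝ, a < b →
      (∀ v : ι → ℝ, v ≠ 0 → ∀ s t : ℝ, a ≤ s → s < t → t ≤ b → v ⬝ᵥ (F s *ᵥ v) ≤ 0 → v ⬝ᵥ (F t *ᵥ v) < 0) →
      Fintype.card {j // (hH a).eigenvalues j < 0} + (Fintype.card ι - (F a).rank)
        ≤ Fintype.card {j // (hH b).eigenvalues j < 0} := by
    intro a b hab hprop
    have hli := Inertia.linearIndependent_subtype_eigen (hH a) (fun j => (hH a).eigenvalues j ≤ 0)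
    have hneg := Inertia.card_le_negIndex (hH b)
      (fun i : {j // (hH a).eigenvalues j ≤ 0} => ((hH a).eigenvectorBasis i.1).ofLp) (fun c hc => by
        refine hprop _ ?_ a b le_rfl hab le_rfl (Inertia.nonpos_eigenFamily (hH a) c)
        intro h0
        exact hc (funext fun i => Fintype.linearIndependent_iff.1 hli c h0 i))
    rw [Inertia.card_nonpos_eigs (hH a)] at hneg
    have hcount := Inertia.negIndex_add_posIndex_add_corank (hH a)
    have := Fintype.card_subtype_le fun j => 0 < (hH a).eigenvalues j
    omega
  intro n
  induction n with
  | zero =>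
    intro a b hab hcard hprop
    rw [Finset.card_eq_zero.1 (Nat.le_zero.1 hcard), Finset.sum_empty, add_zero]
    exact step a b hab hprop
  | succ n ih =>
    intro a b hab hcard hprop
    by_cases hne : (T.filter (fun t => a < t ∧ t < b)).Nonempty
    · obtain ⟨t₀, ht₀⟩ := hne
      obtain ⟨ht₀T, hat₀, ht₀b⟩ := Finset.mem_filter.1 ht₀
      have hsub1 : T.filter (fun t => a < t ∧ t < t₀) ⊆ (T.filter (fun t => a < t ∧ t < b)).erase t₀ := by
        intro t ht
        obtain ⟨htT, h1, h2⟩ := Finset.mem_filter.1 ht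
        exact Finset.mem_erase.2 ⟨ne_of_lt h2, Finset.mem_filter.2 ⟨htT, h1, lt_trans h2 ht₀b⟩⟩
      have hsub2 : T.filter (fun t => t₀ < t ∧ t < b) ⊆ (T.filter (fun t => a < t ∧ t < b)).erase t₀ := by
        intro t ht
        obtain ⟨htT, h1, h2⟩ := Finset.mem_filter.1 ht
        exact Finset.mem_erase.2 ⟨(ne_of_lt h1).symm, Finset.mem_filter.2 ⟨htT, lt_trans hat₀ h1, h2⟩⟩
      have hce := Finset.card_erase_of_mem ht₀
      have hc1 : (T.filter (fun t => a < t ∧ t < t₀)).card ≤ n := by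
        have := Finset.card_le_card hsub1; omega
      have hc2 : (T.filter (fun t => t₀ < t ∧ t < b)).card ≤ n := by
        have := Finset.card_le_card hsub2; omega
      have h1 := ih a t₀ hat₀ hc1
        (fun v hv s t has hst htt => hprop v hv s t has hst (le_trans htt ht₀b.le))
      have h2 := ih t₀ b ht₀b hc2
        (fun v hv s t hts hst htb => hprop v hv s t (le_trans hat₀.le hts) hst htb)
      rw [sum_filter_Ioo_split3 T _ hat₀ ht₀b ht₀T]
      omega
    · rw [Finset.not_nonempty_iff_eq_empty] at hne
      rw [hne, Finset.sum_empty, add_zero]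
      exact step a b hab hprop

/-- **DIRECTED WINDOW, positive form.**  If non-negativity of every Rayleigh form propagates to strict positivity at every
later scale of `[a, b]`, then `π(F(a)) + corank F(a) + ∑_{t ∈ T, a < t < b} corank F(t) ≤ π(F(b))`. [folklore] -/
theorem posIndex_add_sum_corank_le_of_directed (F : ℝ → Matrix ι ι ℝ) (hH : ∀ x, (F x).IsHermitian) (T : Finset ℝ)
    {a b : ℝ} (hab : a < b)
    (hprop : ∀ v : ι → ℝ, v ≠ 0 → ∀ s t : ℝ, a ≤ s → s < t → t ≤ b →
      0 ≤ v ⬝ᵥ (F s *ᵥ v) → 0 < v ⬝ᵥ (F t *ᵥ v)) :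
    Fintype.card {j // 0 < (hH a).eigenvalues j} + (Fintype.card ι - (F a).rank)
        + ∑ t ∈ T.filter (fun t => a < t ∧ t < b), (Fintype.card ι - (F t).rank)
      ≤ Fintype.card {j // 0 < (hH b).eigenvalues j} := by
  have hH' : ∀ x, (-F x).IsHermitian := fun x => (hH x).neg
  have h := negIndex_add_sum_corank_le_of_directed (fun x => -F x) hH' T _ a b hab le_rfl (by
    intro v hv s t has hst htb hfs
    rw [Matrix.neg_mulVec, dotProduct_neg, neg_nonpos] at hfs
    rw [Matrix.neg_mulVec, dotProduct_neg, neg_lt_zero]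
    exact hprop v hv s t has hst htb hfs)
  rw [Inertia.posIndex_eq_negIndex_neg (hH a) (hH' a), Inertia.posIndex_eq_negIndex_neg (hH b) (hH' b)]
  have e1 : (-F a).rank = (F a).rank := Inertia.rank_neg_eq _
  have e2 : ∑ t ∈ T.filter (fun t => a < t ∧ t < b), (Fintype.card ι - (-F t).rank)
      = ∑ t ∈ T.filter (fun t => a < t ∧ t < b), (Fintype.card ι - (F t).rank) :=
    Finset.sum_congr rfl fun t _ => by rw [Inertia.rank_neg_eq]
  rw [e1, e2] at h
  exact h

/-! ## §2 Definite scales -/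

omit [DecidableEq ι] in
/-- A matrix whose form vanishes at no non-zero vector is non-singular. [folklore] -/
theorem det_ne_zero_of_form_ne_zero [DecidableEq ι] {A : Matrix ι ι ℝ} (h : ∀ v : ι → ℝ, v ≠ 0 → v ⬝ᵥ (A *ᵥ v) ≠ 0) :
    A.det ≠ 0 := by
  intro hdet
  obtain ⟨v, hv, hAv⟩ := Matrix.exists_mulVec_eq_zero_iff.2 hdet
  exact h v hv (by rw [hAv, dotProduct_zero])

/-- **Indices of a positive definite scale**: `ν = 0`, `π = card ι`, corank `0`. [folklore] -/
theorem indices_of_pos {A : Matrix ι ι ℝ} (hA : A.IsHermitian) (hpos : ∀ v : ι → ℝ, v ≠ 0 → 0 < v ⬝ᵥ (A *ᵥ v)) :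
    Fintype.card {j // hA.eigenvalues j < 0} = 0 ∧ Fintype.card {j // 0 < hA.eigenvalues j} = Fintype.card ι ∧
      Fintype.card ι - A.rank = 0 := by
  have h := Inertia.card_le_posIndex hA (fun i : ι => fun j : ι => if i = j then (1 : ℝ) else 0) (fun c hc => by
    have e : ∑ i, c i • (fun j : ι => if i = j then (1 : ℝ) else 0) = c := (pi_eq_sum_univ c).symm
    rw [e]; exact hpos c hc)
  have hcount := Inertia.negIndex_add_posIndex_add_corank hA
  omega

/-- **Indices of a negative definite scale**: `ν = card ι`, `π = 0`, corank `0`. [folklore] -/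
theorem indices_of_neg {A : Matrix ι ι ℝ} (hA : A.IsHermitian) (hneg : ∀ v : ι → ℝ, v ≠ 0 → v ⬝ᵥ (A *ᵥ v) < 0) :
    Fintype.card {j // hA.eigenvalues j < 0} = Fintype.card ι ∧ Fintype.card {j // 0 < hA.eigenvalues j} = 0 ∧
      Fintype.card ι - A.rank = 0 := by
  have h := Inertia.card_le_negIndex hA (fun i : ι => fun j : ι => if i = j then (1 : ℝ) else 0) (fun c hc => by
    have e : ∑ i, c i • (fun j : ι => if i = j then (1 : ℝ) else 0) = c := (pi_eq_sum_univ c).symm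
    rw [e]; exact hneg c hc)
  have hcount := Inertia.negIndex_add_posIndex_add_corank hA
  omega

/-! ## §3 Exact kernel count on a window of a lacunary symmetric pencil -/

section Pencil

variable {κ : Type} [Fintype κ]

omit [DecidableEq ι] in
/-- Unwrapping `0 < c·x` / `c·x < 0` for `c > 0`. [folklore] -/
theorem pos_of_mul_pos_left' {c x : ℝ} (hc : 0 < c) (h : 0 < c * x) : 0 < x := by
  rcases mul_pos_iff.1 h with h | h
  · exact h.2
  · exact absurd h.1 (not_lt.2 hc.le)

omit [DecidableEq ι] in
/-- Unwrapping for `c < 0`. [folklore] -/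
theorem neg_of_mul_pos_left' {c x : ℝ} (hc : c < 0) (h : 0 < c * x) : x < 0 := by
  rcases mul_pos_iff.1 h with h | h
  · exact absurd h.1 (not_lt.2 hc.le)
  · exact h.2

/-- **EXACT KERNEL COUNT ON A WINDOW.**  `F(x) = ∑ₖ x^{dₖ} Sₖ` with real symmetric letters, a window `a < b` with
`c·vᵀF(a)v > 0 > c·vᵀF(b)v` for all `v ≠ 0`, in which every Rayleigh form has at most one zero.  Then the kernels at the
roots of `det F` in `(a, b)` have total dimension EXACTLY `card ι`. [folklore] -/
theorem sum_corank_window_eq (d : κ → ℕ) (S : κ → Matrix ι ι ℝ) (hS : ∀ k, (S k).IsSymm) {a b : ℝ} (hab : a < b)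
    (c : ℝ) (hFa : ∀ v : ι → ℝ, v ≠ 0 → 0 < c * (v ⬝ᵥ ((∑ k, a ^ d k • S k) *ᵥ v)))
    (hFb : ∀ v : ι → ℝ, v ≠ 0 → c * (v ⬝ᵥ ((∑ k, b ^ d k • S k) *ᵥ v)) < 0)
    (hone : ∀ v : ι → ℝ, v ≠ 0 → ∀ r₁ r₂ : ℝ, a < r₁ → r₁ < b → a < r₂ → r₂ < b →
      v ⬝ᵥ ((∑ k, r₁ ^ d k • S k) *ᵥ v) = 0 → v ⬝ᵥ ((∑ k, r₂ ^ d k • S k) *ᵥ v) = 0 → r₁ = r₂) :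
    ∑ t ∈ (Matrix.det (∑ k, ((X : ℝ[X]) ^ d k) • (S k).map C)).roots.toFinset.filter (fun t => a < t ∧ t < b),
        (Fintype.card ι - (∑ k, t ^ d k • S k).rank) = Fintype.card ι := by
  classical
  rcases isEmpty_or_nonempty ι with hι | hι
  · rw [Fintype.card_eq_zero]
    exact Finset.sum_eq_zero fun t _ => by simp
  -- the sign `c ≠ 0`
  have hv₀ : (fun _ : ι => (1 : ℝ)) ≠ 0 := fun h => by
    have := congrFun h (Classical.arbitrary ι); simp at this
  have hc0 : c ≠ 0 := by
    intro h; have := hFa _ hv₀; rw [h, zero_mul] at this; exact lt_irrefl 0 this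
  -- the family, its singular set
  have hH : ∀ x, ((fun x : ℝ => ∑ k, x ^ d k • S k) x).IsHermitian := Inertia.isHermitian_pencil d S hS
  have hcont : ∀ i j, Continuous fun x => (fun x : ℝ => ∑ k, x ^ d k • S k) x i j :=
    Inertia.continuous_pencil_entry d S
  set P := Matrix.det (∑ k, ((X : ℝ[X]) ^ d k) • (S k).map C) with hP
  have hdetA : (∑ k, a ^ d k • S k).det ≠ 0 := det_ne_zero_of_form_ne_zero fun v hv h => by
    have := hFa v hv; rw [h, mul_zero] at this
    exact lt_irrefl 0 this
  have hP0 : P ≠ 0 := fun h => hdetA (by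
    have e := eval_det_pencil d S a
    rw [← hP, h, eval_zero] at e
    exact e.symm)
  set T := P.roots.toFinset with hT
  have hTroots : ∀ x ∈ Set.Icc a b, ((fun x : ℝ => ∑ k, x ^ d k • S k) x).det = 0 → x ∈ T :=
    fun x _ hx => Inertia.mem_rootSet_of_det_eq_zero d S hP0 hx
  have haT : a ∉ T := fun h => by
    rw [hT, Multiset.mem_toFinset, mem_roots hP0, IsRoot, hP, eval_det_pencil] at h
    exact hdetA h
  have hIco : T.filter (fun t => a ≤ t ∧ t < b) = T.filter (fun t => a < t ∧ t < b) :=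
    Finset.filter_congr fun t ht =>
      ⟨fun h => ⟨lt_of_le_of_ne h.1 (fun e => haT (e ▸ ht)), h.2⟩, fun h => ⟨h.1.le, h.2⟩⟩
  have hcard_le : ∀ x, Fintype.card {j // (hH x).eigenvalues j < 0} ≤ Fintype.card ι := fun x =>
    Fintype.card_subtype_le _
  have hcard_le' : ∀ x, Fintype.card {j // 0 < (hH x).eigenvalues j} ≤ Fintype.card ι := fun x =>
    Fintype.card_subtype_le _
  rcases lt_or_gt_of_ne hc0 with hc | hc
  · -- `c < 0`: `F(a) ≺ 0 ≺ F(b)`, positivity propagates upward; count with the positive index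
    have hFa' : ∀ v : ι → ℝ, v ≠ 0 → v ⬝ᵥ ((∑ k, a ^ d k • S k) *ᵥ v) < 0 :=
      fun v hv => neg_of_mul_pos_left' hc (hFa v hv)
    have hFb' : ∀ v : ι → ℝ, v ≠ 0 → 0 < v ⬝ᵥ ((∑ k, b ^ d k • S k) *ᵥ v) := fun v hv => by
      have h := hFb v hv
      rcases mul_neg_iff.1 h with h | h
      · exact absurd h.1 (not_lt.2 hc.le)
      · exact h.2
    have hprop : ∀ v : ι → ℝ, v ≠ 0 → ∀ s t : ℝ, a ≤ s → s < t → t ≤ b →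
        0 ≤ v ⬝ᵥ ((fun x : ℝ => ∑ k, x ^ d k • S k) s *ᵥ v) → 0 < v ⬝ᵥ ((fun x : ℝ => ∑ k, x ^ d k • S k) t *ᵥ v) := by
      intro v hv s t has hst htb hfs
      rcases eq_or_lt_of_le htb with rfl | htb'
      · exact hFb' v hv
      have has' : a < s := lt_of_le_of_ne has fun e => by
        rw [← e] at hfs; exact absurd (hFa' v hv) (not_lt.2 hfs)
      exact scalar_up (continuous_form d S v) (hFa' v hv) (hFb' v hv) (hone v hv) has' hst htb' hfs
    have hupper := posIndex_add_sum_corank_le_of_directed _ hH T hab hprop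
    have hlower := Inertia.posIndex_le_add_sum_corank _ hcont hH T hab.le hTroots
    rw [hIco] at hlower
    obtain ⟨-, hπa, hra⟩ := indices_of_neg (hH a) hFa'
    obtain ⟨-, hπb, -⟩ := indices_of_pos (hH b) hFb'
    beta_reduce at hupper hlower hra
    rw [hπa, hra] at hupper
    rw [hπa, hπb] at hlower
    have := hcard_le' b
    omega
  · -- `c > 0`: `F(a) ≻ 0 ≻ F(b)`, negativity propagates upward; count with the negative index
    have hFa' : ∀ v : ι → ℝ, v ≠ 0 → 0 < v ⬝ᵥ ((∑ k, a ^ d k • S k) *ᵥ v) :=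
      fun v hv => pos_of_mul_pos_left' hc (hFa v hv)
    have hFb' : ∀ v : ι → ℝ, v ≠ 0 → v ⬝ᵥ ((∑ k, b ^ d k • S k) *ᵥ v) < 0 := fun v hv => by
      have h := hFb v hv
      rcases mul_neg_iff.1 h with h | h
      · exact h.2
      · exact absurd h.1 (not_lt.2 hc.le)
    have hprop : ∀ v : ι → ℝ, v ≠ 0 → ∀ s t : ℝ, a ≤ s → s < t → t ≤ b →
        v ⬝ᵥ ((fun x : ℝ => ∑ k, x ^ d k • S k) s *ᵥ v) ≤ 0 → v ⬝ᵥ ((fun x : ℝ => ∑ k, x ^ d k • S k) t *ᵥ v) < 0 := by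
      intro v hv s t has hst htb hfs
      rcases eq_or_lt_of_le htb with rfl | htb'
      · exact hFb' v hv
      have has' : a < s := lt_of_le_of_ne has fun e => by
        rw [← e] at hfs; exact absurd (hFa' v hv) (not_lt.2 hfs)
      by_contra hft
      push Not at hft
      have h := scalar_down (continuous_form d S v) (hFa' v hv) (hFb' v hv) (hone v hv) has' hst htb' hft
      exact absurd hfs (not_le.2 h)
    have hupper := negIndex_add_sum_corank_le_of_directed _ hH T _ a b hab le_rfl hprop
    have hlower := Inertia.negIndex_le_add_sum_corank _ hcont hH T hab.le hTroots
    rw [hIco] at hlower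
    obtain ⟨hνa, -, hra⟩ := indices_of_pos (hH a) hFa'
    obtain ⟨hνb, -, -⟩ := indices_of_neg (hH b) hFb'
    beta_reduce at hupper hlower hra
    rw [hνa, hra] at hupper
    rw [hνa, hνb] at hlower
    have := hcard_le b
    omega

/-- **Multiplicity at a window root.**  Under simplicity of the Rayleigh zeros in the window (`P_v′(x) ≠ 0` whenever
`P_v(x) = 0`, `a < x < b`, `v ≠ 0`), every root `t ∈ (a, b)` of `det F` has multiplicity EXACTLY `dim ker F(t)`. [folklore] -/
theorem rootMultiplicity_eq_corank_of_simple (d : κ → ℕ) (S : κ → Matrix ι ι ℝ) (hS : ∀ k, (S k).IsSymm) {a b : ℝ}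
    (hsimple : ∀ v : ι → ℝ, v ≠ 0 → ∀ x : ℝ, a < x → x < b →
      v ⬝ᵥ ((∑ k, x ^ d k • S k) *ᵥ v) = 0 →
        (derivative (∑ k, C (v ⬝ᵥ (S k *ᵥ v)) * (X : ℝ[X]) ^ d k)).eval x ≠ 0)
    {t : ℝ} (hat : a < t) (htb : t < b) :
    (Matrix.det (∑ k, ((X : ℝ[X]) ^ d k) • (S k).map C)).rootMultiplicity t
      = Fintype.card ι - (∑ k, t ^ d k • S k).rank :=
  (Multiplicity.rootMultiplicity_det_pencil_eq_corank d S hS t fun v hv hv0 =>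
    hsimple v hv0 t hat htb (by rw [hv, dotProduct_zero])).2

/-- **EXACT ROOT COUNT WITH MULTIPLICITY ON A WINDOW.**  Under the hypotheses of `sum_corank_window_eq` and simplicity
of the Rayleigh zeros in the window, `det F` has EXACTLY `card ι` roots in `(a, b)` counted with multiplicity. [folklore] -/
theorem card_roots_window_eq (d : κ → ℕ) (S : κ → Matrix ι ι ℝ) (hS : ∀ k, (S k).IsSymm) {a b : ℝ} (hab : a < b)
    (c : ℝ) (hFa : ∀ v : ι → ℝ, v ≠ 0 → 0 < c * (v ⬝ᵥ ((∑ k, a ^ d k • S k) *ᵥ v)))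
    (hFb : ∀ v : ι → ℝ, v ≠ 0 → c * (v ⬝ᵥ ((∑ k, b ^ d k • S k) *ᵥ v)) < 0)
    (hone : ∀ v : ι → ℝ, v ≠ 0 → ∀ r₁ r₂ : ℝ, a < r₁ → r₁ < b → a < r₂ → r₂ < b →
      v ⬝ᵥ ((∑ k, r₁ ^ d k • S k) *ᵥ v) = 0 → v ⬝ᵥ ((∑ k, r₂ ^ d k • S k) *ᵥ v) = 0 → r₁ = r₂)
    (hsimple : ∀ v : ι → ℝ, v ≠ 0 → ∀ x : ℝ, a < x → x < b →
      v ⬝ᵥ ((∑ k, x ^ d k • S k) *ᵥ v) = 0 →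
        (derivative (∑ k, C (v ⬝ᵥ (S k *ᵥ v)) * (X : ℝ[X]) ^ d k)).eval x ≠ 0) :
    Multiset.card ((Matrix.det (∑ k, ((X : ℝ[X]) ^ d k) • (S k).map C)).roots.filter (fun t => a < t ∧ t < b))
      = Fintype.card ι := by
  classical
  set P := Matrix.det (∑ k, ((X : ℝ[X]) ^ d k) • (S k).map C) with hP
  rw [← sum_corank_window_eq d S hS hab c hFa hFb hone, ← Multiset.toFinset_sum_count_eq, Multiset.toFinset_filter]
  refine Finset.sum_congr rfl fun t ht => ?_
  obtain ⟨-, hat, htb⟩ := Finset.mem_filter.1 ht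
  rw [Multiset.count_filter_of_pos (p := fun t => a < t ∧ t < b) (Finset.mem_filter.1 ht).2, count_roots,
    rootMultiplicity_eq_corank_of_simple d S hS hsimple hat htb]

end Pencil

end DefiniteMoments

end Summit.ValiantsHypothesis.ValiantsHypothesis.Theorems.LacunarySymmetroidMatrixDescartes
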